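import Summits.QuantumFields.YangMills.Theses.ConvexGribovBody
import Summits.QuantumFields.YangMills.Theorems.OneCertifiedCubeFiniteSizeCriterion
import HarnessLib

/-!
# Monotonicity of the v5 reshape of line `Sketch`: cell analyticity ⇒ weak mixing on cubes
# (stub `stub_boxInfluenceDecay_of_cellAnalyticityNSC` of crux stmt-QuantumFields-16405, route `ConvexGribovBody`)

Given antitonicity of the boundary influence in the volume (hypothesis W, = stub `stub_influence_antitone`), the old
C⁺ of line `Sketch` (Dobrushin–Shlosman TV finite-size condition at some `(n, ε, b)` at every `β ≥ β₂`, all cell unions)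
implies the new C⁺ (weak mixing on cubes `[−L,L]⁴` for gauge-invariant local observables, rate `m(β) > 0`): the tree's
`FiniteSizeCriterion.box_influence_le` bounds the influence on the box of cells of radius `R_A + k(2n+1)` (links
`[−bL', b(L'+1))⁴ × univ`, `L' = R_A + k(2n+1)`) by `2‖A‖∞ (2R_A+1)⁴ (εM(n))^k`; every cube `Λ_L` with `L + 1 ≥ b(R_A+1)`
contains such a box with `k = ⌊((L+1)/b − R_A − 1)/(2n+1)⌋`, W transports the bound to `Λ_L`, and
`(εM(n))^k ≤ max(εM(n),1/2)^k ≤ e^{κ(R_A+2n+3)} e^{−(κ/b) L}`, `κ = −log max(εM(n),1/2)/(2n+1)`; small `L`: trivial bound `2‖A‖∞`.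
Template for the arithmetic: `FiniteSizeCriterion_proof`.
-/

set_option autoImplicit false

noncomputable section

open MeasureTheory Filter
open Literature.Probability.LatticeModels
open Literature.MathematicalPhysics.QuantumLattice
open Literature.MathematicalPhysics.QuantumFieldTheory (isSpecification_ymSpecification_of_t2Space)

namespace Summit.QuantumFields.YangMills.Theorems.NonSimplyConnectedLatticeGap

/-- **Cell analyticity at large `β` ⇒ weak mixing on cubes at large `β`, given antitonicity of the influence**
(registered stub `stub_boxInfluenceDecay_of_cellAnalyticityNSC` of the skeleton
`Cruxes/NonSimplyConnectedLatticeGap/Lines/Sketch.lean` v5 of item stmt-QuantumFields-16405). -/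
theorem stub_boxInfluenceDecay_of_cellAnalyticityNSC : (∀ (V S : Type) [MeasurableSpace S] (γ : Literature.Probability.LatticeModels.Specification V S), Literature.Probability.LatticeModels.IsSpecification γ → ∀ (Λ Λ' : Finset V), Λ ⊆ Λ' → ∀ (f : (V → S) → ℝ), Measurable f → ∀ (B : ℝ), (∀ σ, |f σ| ≤ B) → ∀ (Δ : ℝ), (∀ ξ ξ' : V → S, |(∫ σ, f σ ∂(γ Λ ξ)) - ∫ σ, f σ ∂(γ Λ ξ')| ≤ Δ) → ∀ η η' : V → S, |(∫ σ, f σ ∂(γ Λ' η)) - ∫ σ, f σ ∂(γ Λ' η')| ≤ Δ) → (∀ (G : Type) [Group G] [TopologicalSpace G] [IsTopologicalGroup G] [CompactSpace G] [MeasurableSpace G] [BorelSpace G], Literature.MathematicalPhysics.QuantumFieldTheory.IsCompactSimpleLieGroup G → ¬ SimplyConnectedSpace G → ∀ r : Literature.MathematicalPhysics.QuantumFieldTheory.LatticeRep G, ∃ β₂ : ℝ, ∀ β : ℝ, β₂ ≤ β → ∃ (n : ℕ) (ε : ℝ) (b : ℕ), 1 ≤ n ∧ 0 ≤ ε ∧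 ε * ((((4 * n + 3) ^ 4 - (4 * n + 1) ^ 4 : ℕ)) : ℝ) < 1 ∧ 1 ≤ b ∧ (∀ w : Fin 4 → ℤ → ℤ, (∀ i j, w i j + ((b : ℕ) : ℤ) ≤ w i (j + 1) ∧ w i (j + 1) ≤ w i j + 2 * ((b : ℕ) : ℤ)) → ∀ Y : Finset (Fin 4 → ℤ), Y ⊆ (Fintype.piFinset fun _ : Fin 4 => Finset.Icc (-(2 * ((n : ℕ) : ℤ))) (2 * ((n : ℕ) : ℤ))) → (0 : Fin 4 → ℤ) ∈ Y → ∀ η η' : Literature.MathematicalPhysics.QuantumLattice.LGConfig 4 G, (∀ e ∈ (Fintype.piFinset fun _ : Fin 4 => Finset.Icc (-(2 * ((n : ℕ) : ℤ))) (2 * ((n : ℕ) : ℤ))).biUnion (fun y : Fin 4 → ℤ => (Fintype.piFinset fun i : Fin 4 => Finset.Ico (w i (y i)) (w i (y i + 1))) ×ˢ (Finset.univ : Finset (Fin 4))), η e = η' e) → ∀ f : Literature.MathematicalPhysics.QuantumLattice.LGConfig 4 G → ℝ, Literature.MathematicalPhysics.QuantumLattice.IsCylinder f ((fun y : Fin 4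 → ℤ => (Fintype.piFinset fun i : Fin 4 => Finset.Ico (w i (y i)) (w i (y i + 1))) ×ˢ (Finset.univ : Finset (Fin 4))) 0) → Measurable f → (∀ U, 0 ≤ f U ∧ f U ≤ 1) → |(∫ U, f U ∂(Literature.MathematicalPhysics.QuantumLattice.ymSpecification r.ρ β (Y.biUnion (fun y : Fin 4 → ℤ => (Fintype.piFinset fun i : Fin 4 => Finset.Ico (w i (y i)) (w i (y i + 1))) ×ˢ (Finset.univ : Finset (Fin 4)))) η)) - ∫ U, f U ∂(Literature.MathematicalPhysics.QuantumLattice.ymSpecification r.ρ β (Y.biUnion (fun y : Fin 4 → ℤ => (Fintype.piFinset fun i : Fin 4 => Finset.Ico (w i (y i)) (w i (y i + 1))) ×ˢ (Finset.univ : Finset (Fin 4)))) η')| ≤ ε)) → ∀ (G : Type) [Group G] [TopologicalSpace G] [IsTopologicalGroup G] [CompactSpace G] [MeasurableSpace G] [BorelSpace G], Literature.MathematicalPhysics.QuantumFieldTheory.IsCompactSimpleLieGroup G → ¬ SimplyConnectedSpace G → ∀ r : Literature.MathematicalPhysics.QuantumFieldTheory.LatticeRep G, ∃ β₂ : ℝ,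 ∀ β : ℝ, β₂ ≤ β → ∃ m : ℝ, 0 < m ∧ ∀ A : Literature.MathematicalPhysics.QuantumFieldTheory.YMSpecies G, ∃ C : ℝ, ∀ (L : ℕ) (η η' : Literature.MathematicalPhysics.QuantumLattice.LGConfig 4 G), |(∫ U, A.F U ∂(Literature.MathematicalPhysics.QuantumLattice.ymSpecification r.ρ β ((Fintype.piFinset fun _ : Fin 4 => Finset.Icc (-((L : ℕ) : ℤ)) ((L : ℕ) : ℤ)) ×ˢ (Finset.univ : Finset (Fin 4))) η)) - ∫ U, A.F U ∂(Literature.MathematicalPhysics.QuantumLattice.ymSpecification r.ρ β ((Fintype.piFinset fun _ : Fin 4 => Finset.Icc (-((L : ℕ) : ℤ)) ((L : ℕ) : ℤ)) ×ˢ (Finset.univ : Finset (Fin 4))) η')| ≤ C * Real.exp (-(m * L)) := by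
  classical
  intro hW hOld G _ _ _ _ _ _ hG hnsc r
  obtain ⟨β₂, hβ₂⟩ := hOld G hG hnsc r
  refine ⟨β₂, fun β hβ => ?_⟩
  obtain ⟨n, ε, b, _hn, hε, hεM, hb, hFS⟩ := hβ₂ β hβ
  haveI : T2Space G := (r.continuous.isClosedEmbedding r.injective).isEmbedding.t2Space
  haveI : SecondCountableTopology G :=
    (r.continuous.isClosedEmbedding r.injective).isEmbedding.secondCountableTopology
  -- the decay rate (as in `FiniteSizeCriterion_proof`)
  set q : ℝ := ε * ((((4 * n + 3) ^ 4 - (4 * n + 1) ^ 4 : ℕ)) : ℝ) with hq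
  have hq0 : 0 ≤ q := by rw [hq]; positivity
  set r₀ : ℝ := max q (1 / 2)
  have hr0 : 0 < r₀ := lt_of_lt_of_le (by norm_num) (le_max_right _ _)
  have hr1 : r₀ < 1 := max_lt hεM (by norm_num)
  have hqr0 : q ≤ r₀ := le_max_left _ _
  have hlogr : Real.log r₀ < 0 := Real.log_neg hr0 hr1
  set κ : ℝ := -Real.log r₀ / (2 * n + 1) with hκ
  have hn1 : (0 : ℝ) < 2 * n + 1 := by positivity
  have hκ0 : 0 < κ := by rw [hκ]; exact div_pos (by linarith) hn1
  have hlogr' : Real.log r₀ = -(κ * (2 * n + 1)) := by rw [hκ]; field_simp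
  have hbR : (1 : ℝ) ≤ b := by exact_mod_cast hb
  have hbR0 : (0 : ℝ) < b := by linarith
  refine ⟨κ / b, div_pos hκ0 hbR0, fun A => ?_⟩
  obtain ⟨CA, hCA⟩ := A.bounded
  have hCA0 : 0 ≤ CA := (abs_nonneg _).trans (hCA fun _ => 1)
  -- the radius of the support of `A`
  set RA : ℕ := A.supp.sup fun e => Finset.univ.sup fun i => (e.1 i).natAbs
  have hRA : ∀ e ∈ A.supp, ∀ i, |e.1 i| ≤ RA := fun e he i => by
    rw [Int.abs_eq_natAbs, Int.ofNat_le]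
    exact (Finset.le_sup (f := fun i => (e.1 i).natAbs) (Finset.mem_univ i)).trans
      (Finset.le_sup (f := fun e : ZdEdge 4 => Finset.univ.sup fun i => (e.1 i).natAbs) he)
  clear_value RA
  -- the specification and the engine bound on the boxes of cells of radius `R_A + k(2n+1)`
  have hγ := isSpecification_ymSpecification_of_t2Space (d := 4) r.ρ r.continuous β
  have hMeq : (((2 * (2 * n + 1) + 1) ^ 4 - (2 * (2 * n) + 1) ^ 4 : ℕ) : ℝ) =
      (((4 * n + 3) ^ 4 - (4 * n + 1) ^ 4 : ℕ) : ℝ) := by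
    have h1 : 2 * (2 * n + 1) + 1 = 4 * n + 3 := by ring
    have h2 : 2 * (2 * n) + 1 = 4 * n + 1 := by ring
    rw [h1, h2]
  have hinfl : ∀ (k : ℕ) (ξ ξ' : LGConfig 4 G),
      |(∫ U, A.F U ∂(ymSpecification r.ρ β ((Fintype.piFinset fun _ : Fin 4 =>
          Finset.Ico (-((b : ℤ) * (RA + k * (2 * n + 1) : ℕ)))
            ((b : ℤ) * ((RA + k * (2 * n + 1) : ℕ) + 1))) ×ˢ (Finset.univ : Finset (Fin 4))) ξ)) -
        ∫ U, A.F U ∂(ymSpecification r.ρ β ((Fintype.piFinset fun _ : Fin 4 =>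
          Finset.Ico (-((b : ℤ) * (RA + k * (2 * n + 1) : ℕ)))
            ((b : ℤ) * ((RA + k * (2 * n + 1) : ℕ) + 1))) ×ˢ (Finset.univ : Finset (Fin 4))) ξ')| ≤
        2 * CA * ((2 * RA + 1) ^ 4 * q ^ k) := by
    intro k ξ ξ'
    have h := FiniteSizeCriterion.box_influence_le r.ρ r.continuous β hb hε hFS k RA A.measurable
      hCA A.isCylinder hRA ξ ξ'
    rwa [hMeq, ← hq] at h
  -- the constant
  set c0 : ℝ := RA + 2 * n + 3 with hc0
  clear_value q r₀ κ c0
  refine ⟨2 * CA * (2 * RA + 1) ^ 4 * Real.exp (κ * c0), ?_⟩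
  intro L η η'
  -- the cube `Λ_L`
  obtain ⟨Λ₀, hΛ₀⟩ : ∃ Λ₀ : Finset (ZdEdge 4), Λ₀ = (Fintype.piFinset fun _ : Fin 4 =>
      Finset.Icc (-((L : ℕ) : ℤ)) ((L : ℕ) : ℤ)) ×ˢ (Finset.univ : Finset (Fin 4)) := ⟨_, rfl⟩
  rw [← hΛ₀]
  have hC0 : 0 ≤ 2 * CA * (2 * RA + 1 : ℝ) ^ 4 := by positivity
  have hRA1 : (1 : ℝ) ≤ (2 * RA + 1 : ℝ) ^ 4 :=
    one_le_pow₀ (by linarith only [(Nat.cast_nonneg RA : (0 : ℝ) ≤ RA)])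
  have hgoal : ∀ {x : ℝ}, x ≤ 2 * CA * (2 * RA + 1) ^ 4 * Real.exp (κ * c0 - κ / b * L) →
      x ≤ 2 * CA * (2 * RA + 1) ^ 4 * Real.exp (κ * c0) * Real.exp (-(κ / b * L)) := by
    intro x hx
    rwa [mul_assoc _ (Real.exp _), ← Real.exp_add, ← sub_eq_add_neg]
  -- the trivial bound
  have htriv : |(∫ U, A.F U ∂(ymSpecification r.ρ β Λ₀ η)) -
      ∫ U, A.F U ∂(ymSpecification r.ρ β Λ₀ η')| ≤ 2 * CA := by
    have h1 := abs_integral_ymSpecification_le r.ρ r.continuous β Λ₀ hCA η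
    have h2 := abs_integral_ymSpecification_le r.ρ r.continuous β Λ₀ hCA η'
    calc _ ≤ |∫ U, A.F U ∂(ymSpecification r.ρ β Λ₀ η)| +
          |∫ U, A.F U ∂(ymSpecification r.ρ β Λ₀ η')| := abs_sub _ _
      _ ≤ CA + CA := add_le_add h1 h2
      _ = 2 * CA := by ring
  apply hgoal
  by_cases hcase : b * (RA + 1) ≤ L + 1
  swap
  · -- few sites: the trivial bound suffices
    have hLlt : L + 1 < b * (RA + 1) := not_le.1 hcase
    have htb : (L : ℝ) ≤ b * c0 := by
      have h1 : ((L + 1 : ℕ) : ℝ) < ((b * (RA + 1) : ℕ) : ℝ) := by exact_mod_cast hLlt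
      push_cast at h1
      have h4 : (0 : ℝ) ≤ (b : ℝ) * (2 * n + 2) := by positivity
      rw [hc0]
      linarith only [h1, h4]
    have hexp : 1 ≤ Real.exp (κ * c0 - κ / b * L) := by
      refine Real.one_le_exp ?_
      rw [sub_nonneg, div_mul_eq_mul_div, mul_div_assoc]
      exact mul_le_mul_of_nonneg_left ((div_le_iff₀ hbR0).2 (by linarith only [htb])) hκ0.le
    calc _ ≤ 2 * CA := htriv
      _ = 2 * CA * 1 * 1 := by ring
      _ ≤ 2 * CA * (2 * RA + 1) ^ 4 * Real.exp (κ * c0 - κ / b * L) := by gcongr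
  · -- the main case: the box of cells of radius `R_A + k(2n+1)` fits in the cube
    obtain ⟨D, hD⟩ : ∃ D : ℕ, D = (L + 1) / b := ⟨_, rfl⟩
    have hDb : D * b ≤ L + 1 := by rw [hD]; exact Nat.div_mul_le_self _ _
    have hltD : L + 1 < D * b + b := by rw [hD]; exact Nat.lt_div_mul_add (by omega)
    have hRD : RA + 1 ≤ D := by rw [hD]; exact (Nat.le_div_iff_mul_le (by omega)).2 (by
      simpa only [Nat.mul_comm] using hcase)
    obtain ⟨k, hk⟩ : ∃ k : ℕ, k = (D - (RA + 1)) / (2 * n + 1) := ⟨_, rfl⟩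
    have hkQ : k * (2 * n + 1) ≤ D - (RA + 1) := by rw [hk]; exact Nat.div_mul_le_self _ _
    have hlt : D - (RA + 1) < k * (2 * n + 1) + (2 * n + 1) := by
      rw [hk]; exact Nat.lt_div_mul_add (by omega)
    obtain ⟨T, hT⟩ : ∃ T : ℕ, T = k * (2 * n + 1) := ⟨_, rfl⟩
    rw [← hT] at hkQ hlt
    obtain ⟨M, hM⟩ : ∃ M : ℕ, M = RA + k * (2 * n + 1) := ⟨_, rfl⟩
    have hMT : M = RA + T := by rw [hM, hT]
    have hM1 : M + 1 ≤ D := by omega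
    have hD2 : D + 1 ≤ T + RA + 2 * n + 2 := by omega
    -- `b (M + 1) ≤ L + 1` (the box fits) and `L + 1 < b (T + R_A + 2n + 2)` (the exponent)
    have hfit : b * (M + 1) ≤ L + 1 :=
      (Nat.mul_le_mul_left b hM1).trans (by simpa only [Nat.mul_comm] using hDb)
    have hL3 : L + 1 < b * (T + RA + 2 * n + 2) :=
      calc L + 1 < D * b + b := hltD
        _ = b * (D + 1) := by ring
        _ ≤ b * (T + RA + 2 * n + 2) := Nat.mul_le_mul_left b hD2
    have hb1 : (1 : ℤ) ≤ b := by exact_mod_cast hb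
    have hI : (b : ℤ) * (M + 1) ≤ L + 1 := by exact_mod_cast hfit
    have hM0 : (0 : ℤ) ≤ M := Nat.cast_nonneg M
    -- the box `Λ` of cells of radius `M`
    obtain ⟨Λ, hΛ⟩ : ∃ Λ : Finset (ZdEdge 4), Λ = (Fintype.piFinset fun _ : Fin 4 =>
      Finset.Ico (-((b : ℤ) * M)) ((b : ℤ) * (M + 1))) ×ˢ (Finset.univ : Finset (Fin 4)) :=
      ⟨_, rfl⟩
    have hsub : Λ ⊆ Λ₀ := by
      intro e he
      rw [hΛ, Finset.mem_product, Fintype.mem_piFinset] at he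
      rw [hΛ₀, Finset.mem_product, Fintype.mem_piFinset]
      refine ⟨fun i => ?_, Finset.mem_univ _⟩
      have h := Finset.mem_Ico.1 (he.1 i)
      rw [Finset.mem_Icc]
      constructor <;> nlinarith only [h.1, h.2, hI, hb1, hM0]
    -- the engine bound on `Λ`, transported to `Λ₀` by antitonicity
    have hinflk : ∀ ξ ξ' : LGConfig 4 G, |(∫ U, A.F U ∂(ymSpecification r.ρ β Λ ξ)) -
        ∫ U, A.F U ∂(ymSpecification r.ρ β Λ ξ')| ≤ 2 * CA * ((2 * RA + 1) ^ 4 * q ^ k) := by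
      intro ξ ξ'
      have h := hinfl k ξ ξ'
      rwa [← hM, ← hΛ] at h
    have key := hW (ZdEdge 4) G (ymSpecification r.ρ β) hγ Λ Λ₀ hsub A.F A.measurable CA hCA
      (2 * CA * ((2 * RA + 1) ^ 4 * q ^ k)) hinflk η η'
    -- compare with `C e^{−(κ/b) L}`
    have hqk : q ^ k ≤ Real.exp (κ * c0 - κ / b * L) := by
      have hqr : q ^ k ≤ r₀ ^ k := pow_le_pow_left₀ hq0 hqr0 k
      refine hqr.trans ?_
      rw [← Real.exp_log (pow_pos hr0 k), Real.exp_le_exp, Real.log_pow, hlogr']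
      -- `L ≤ b ((2n+1) k + c0)`
      have htb : (L : ℝ) ≤ b * ((2 * n + 1) * k + c0) := by
        have h1 : ((L + 1 : ℕ) : ℝ) < ((b * (T + RA + 2 * n + 2) : ℕ) : ℝ) := by
          exact_mod_cast hL3
        push_cast at h1
        have h2 : (b : ℝ) * T = b * (k * (2 * n + 1)) := by rw [hT]; push_cast; ring
        have h3 : (0 : ℝ) ≤ (b : ℝ) := hbR0.le
        rw [hc0]
        linarith only [h1, h2, h3]
      have htb' : κ / b * L ≤ κ * ((2 * n + 1) * k + c0) := by
        rw [div_mul_eq_mul_div, mul_div_assoc]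
        exact mul_le_mul_of_nonneg_left ((div_le_iff₀ hbR0).2 (by linarith only [htb])) hκ0.le
      linarith only [htb']
    calc _ ≤ 2 * CA * ((2 * RA + 1) ^ 4 * q ^ k) := key
      _ = 2 * CA * (2 * RA + 1) ^ 4 * q ^ k := by ring
      _ ≤ 2 * CA * (2 * RA + 1) ^ 4 * Real.exp (κ * c0 - κ / b * L) :=
          mul_le_mul_of_nonneg_left hqk hC0

end Summit.QuantumFields.YangMills.Theorems.NonSimplyConnectedLatticeGap

end
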